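import Summits.ResolutionOfSingularities.ResolutionOfSingularities.Theses.FoliationDescent
import Summits.ResolutionOfSingularities.ResolutionOfSingularities.Theorems.FoliationDescentFolLUStubSaturation
import Summits.ResolutionOfSingularities.ResolutionOfSingularities.Theorems.FoliationDescentFolLUStubRegularAtCtrBlowupChart
import Literature.RingTheory.Localization.DerivationFractionField
import HarnessLib

/-!
# Crux `FolLU` (stmt-ResolutionOfSingularities-17081), line `birth`
# — stub `stub_folLU_of_essFiniteType`

**`FolLU` is automatic along valuation rings essentially of finite type.**
Let `k ⊆ K` be fields, `O` a valuation ring of `K`, `S ⊆ O` a finitely generated `k`-subalgebra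
with `Frac S = K`, regular at the centre of `O`, and `D ≠ 0` a (`p`-closed) `k`-derivation of
`K`. If `O = (S₀)_c` is the local ring at the centre of some finitely generated `S₀ ⊆ O` (the
trivial valuation, or a divisorial one), then the conclusion of `FolLU` holds, with the
NON-SINGULAR alternative.

Proof. (1) `S' := S ⊔ S₀` is finitely generated, `S ≤ S' ≤ O`, `Frac S' = K` (the landed
`BlowupChartRegular.isFractionRing_of_le`). (2) `S'_c = O`.
(3) `O` is the localisation of the Noetherian ring `S'` at its centre, hence a Noetherian valuation
ring, i.e. a principal ideal domain [Matsumura, CRT, Thm. 11.1], i.e. a regular local ring of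
dimension `≤ 1`; so `S'_c ≅ O` is regular. (4) The landed stub `stub_saturation` rescales `D` to
`g • D` preserving `S'_c = O` and saturated there. (5) If `O` is a field, any `a ∈ S` with
`D a ≠ 0` is a witness; otherwise saturation at a uniformiser `π` of the discrete valuation ring
`O` produces `x ∈ O` with `(g • D) x ∉ π O = 𝔪_O`, i.e. `(g • D) x ∈ O^×`.

References: H. Matsumura, *Commutative Ring Theory*, CUP 1986, Thm. 11.1 (PDF p. 93);
A. N. Rudakov, I. R. Shafarevich, *Inseparable morphisms of algebraic surfaces* (1976), §1.
-/

set_option linter.dupNamespace false -- mandated namespace of this single-conjunct summit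

noncomputable section

namespace Summit.ResolutionOfSingularities.ResolutionOfSingularities.Theorems.FolLU

namespace EssFiniteType

/-- A valuation subring `O` of `K` containing a `k`-subalgebra `S` contains the image of `k`,
hence is the underlying subring of a `k`-subalgebra of `K`. [folklore] -/
theorem exists_subalgebra_of_valuationSubring {k K : Type*} [Field k] [Field K] [Algebra k K]
    (O : ValuationSubring K) (S : Subalgebra k K) (hS : S.toSubring ≤ O.toSubring) :
    ∃ OA : Subalgebra k K, ∀ x : K, x ∈ OA ↔ x ∈ O :=
  ⟨{ O.toSubring with
      algebraMap_mem' := fun r => hS (S.algebraMap_mem r) }, fun _ => Iff.rfl⟩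

/-- **`O = S_c` as a localisation.** If every element of the valuation ring `O ⊇ S` is a fraction
`a / b` with `a b ∈ S` and `b` a unit of `O`, then `O` is the localisation of `S` at its centre
`𝔭 = S ∩ 𝔪_O` (along the inclusion `S ⊆ O`). [folklore] -/
theorem isLocalization_at_centre {k K : Type*} [Field k] [Field K] [Algebra k K]
    (O : ValuationSubring K) (S : Subalgebra k K) (hS : S.toSubring ≤ O.toSubring)
    (hO : ∀ x : K, x ∈ O → ∃ a b : K, a ∈ S ∧ b ∈ S ∧ b ≠ 0 ∧ b⁻¹ ∈ O ∧ x = a / b) :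
    @IsLocalization _ _
      (Ideal.comap (Subring.inclusion hS) (IsLocalRing.maximalIdeal O)).primeCompl O _
      (Subring.inclusion hS).toAlgebra := by
  letI : Algebra S.toSubring O := (Subring.inclusion hS).toAlgebra
  set P : Ideal S.toSubring := Ideal.comap (Subring.inclusion hS) (IsLocalRing.maximalIdeal O)
    with hP
  have hPc : ∀ s : S.toSubring, s ∈ P.primeCompl ↔ ((s : K) ≠ 0 ∧ (s : K)⁻¹ ∈ O) := by
    intro s
    rw [Ideal.mem_primeCompl_iff, hP, Ideal.mem_comap, not_mem_maximalIdeal_iff_inv_mem]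
    rfl
  rw [isLocalization_iff]
  refine ⟨fun s => ?_, fun z => ?_, fun {x y} hxy => ?_⟩
  · have h1 : (s : S.toSubring) ∉ P := Ideal.mem_primeCompl_iff.mp s.2
    rw [hP, Ideal.mem_comap, IsLocalRing.mem_maximalIdeal, mem_nonunits_iff, not_not] at h1
    exact h1
  · obtain ⟨a, b, ha, hb, hb0, hbinv, hz⟩ := hO z z.2
    refine ⟨(⟨a, ha⟩, ⟨⟨b, hb⟩, (hPc ⟨b, hb⟩).mpr ⟨hb0, hbinv⟩⟩), Subtype.ext ?_⟩
    change (z : K) * b = a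
    rw [hz, div_mul_cancel₀ a hb0]
  · have hxy' : (x : K) = y := congrArg (fun z : O => (z : K)) hxy
    exact ⟨1, by rw [Subtype.ext hxy']⟩

/-- **Regularity at the centre when `O = S_c` is essentially of finite type.** If `S ⊆ O` is
finitely generated and `O = S_c`, then `O ≅ S_𝔭` is Noetherian, hence — a Noetherian valuation
ring — a principal ideal domain, hence a regular local ring; and so is `S_𝔭`.
[cite: Matsumura1987, Thm. 11.1 (PDF p. 93)] -/
theorem isPrincipalIdealRing_and_isRegularLocalRing {k K : Type} [Field k] [Field K]
    [Algebra k K] (O : ValuationSubring K) (S : Subalgebra k K)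
    (hS : S.toSubring ≤ O.toSubring) (hfg : S.FG)
    (hO : ∀ x : K, x ∈ O → ∃ a b : K, a ∈ S ∧ b ∈ S ∧ b ≠ 0 ∧ b⁻¹ ∈ O ∧ x = a / b) :
    IsPrincipalIdealRing O ∧
      IsRegularLocalRing (Localization.AtPrime
        (Ideal.comap (Subring.inclusion hS) (IsLocalRing.maximalIdeal O))) := by
  letI : Algebra S.toSubring O := (Subring.inclusion hS).toAlgebra
  set P : Ideal S.toSubring := Ideal.comap (Subring.inclusion hS) (IsLocalRing.maximalIdeal O)
    with hP
  haveI hloc : IsLocalization P.primeCompl O := isLocalization_at_centre O S hS hO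
  haveI hNS : IsNoetherianRing S.toSubring := isNoetherianRing_of_fg hfg
  haveI : IsNoetherianRing O := IsLocalization.isNoetherianRing P.primeCompl O hNS
  haveI hPID : IsPrincipalIdealRing O := inferInstance
  haveI : IsRegularLocalRing O := inferInstance
  exact ⟨hPID, IsRegularLocalRing.of_ringEquiv
    (IsLocalization.algEquiv P.primeCompl (Localization.AtPrime P) O).symm.toRingEquiv⟩

end EssFiniteType

open EssFiniteType in
/-- STUB `stub_folLU_of_essFiniteType` of the crux `FolLU` (line `birth`), in expanded
(definition-free) form: **`FolLU` holds, with the non-singular alternative, along every valuation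
ring `O` essentially of finite type** (`O = (S₀)_c` for a finitely generated `S₀ ⊆ O`: the
trivial or a divisorial valuation). On the model `S' := S ⊔ S₀` one has `S'_c = O`, a Noetherian
valuation ring, i.e. a discrete valuation ring or a field; the saturated rescaling `g • D` of the
landed stub `stub_saturation` is then non-singular at the centre (saturation at a uniformiser).
[cite: Matsumura1987, Thm. 11.1 (PDF p. 93)] [cite: RudakovShafarevich1976, §1] -/
theorem stub_folLU_of_essFiniteType :
    ∀ p : ℕ, p.Prime → ∀ (k K : Type) [Field k] [CharP k p] [PerfectField k] [Field K] [Algebra k K]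
    (O : ValuationSubring K) (S : Subalgebra k K) (hS : S.toSubring ≤ O.toSubring)
    (D : Derivation k K K), S.FG → IsFractionRing S K →
    IsRegularLocalRing
      (Localization.AtPrime (Ideal.comap (Subring.inclusion hS) (IsLocalRing.maximalIdeal O))) →
    D ≠ 0 → (∃ c : K, ∀ x : K, (⇑D)^[p] x = c * D x) →
    (∃ S₀ : Subalgebra k K, S₀.FG ∧ S₀.toSubring ≤ O.toSubring ∧
      ∀ x : K, x ∈ O → ∃ a b : K, a ∈ S₀ ∧ b ∈ S₀ ∧ b ≠ 0 ∧ b⁻¹ ∈ O ∧ x = a / b) →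
    ∃ (S' : Subalgebra k K) (h' : S'.toSubring ≤ O.toSubring) (g : K), S ≤ S' ∧ S'.FG ∧
      IsFractionRing S' K ∧
      IsRegularLocalRing
        (Localization.AtPrime (Ideal.comap (Subring.inclusion h') (IsLocalRing.maximalIdeal O))) ∧
      g ≠ 0 ∧
      (∀ x : K, (∃ a b : K, a ∈ S' ∧ b ∈ S' ∧ b ≠ 0 ∧ b⁻¹ ∈ O ∧ x = a / b) →
        ∃ a b : K, a ∈ S' ∧ b ∈ S' ∧ b ≠ 0 ∧ b⁻¹ ∈ O ∧ (g • D) x = a / b) ∧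
      ((∃ x : K, (∃ a b : K, a ∈ S' ∧ b ∈ S' ∧ b ≠ 0 ∧ b⁻¹ ∈ O ∧ x = a / b) ∧ (g • D) x ≠ 0 ∧
          ((g • D) x)⁻¹ ∈ O) ∨
        (∃ u : K, (∃ a b : K, a ∈ S' ∧ b ∈ S' ∧ b ≠ 0 ∧ b⁻¹ ∈ O ∧ u = a / b) ∧ u ≠ 0 ∧
          u⁻¹ ∈ O ∧ ∀ x : K, (⇑(g • D))^[p] x = u * (g • D) x)) := by
  intro p hp k K _ _ _ _ _ O S hS D hfg hfrac _hreg hD hpc hess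
  obtain ⟨S₀, hfg₀, hS₀, hO⟩ := hess
  -- (1) the model `S' := S ⊔ S₀`: finitely generated, `S ≤ S' ≤ O`, `Frac S' = K`
  obtain ⟨OA, hOA⟩ := exists_subalgebra_of_valuationSubring O S hS
  have hSOA : S ≤ OA := fun x hx => (hOA x).mpr (hS hx)
  have hS₀OA : S₀ ≤ OA := fun x hx => (hOA x).mpr (hS₀ hx)
  have h' : (S ⊔ S₀).toSubring ≤ O.toSubring := fun x hx => (hOA x).mp (sup_le hSOA hS₀OA hx)
  have hle : S ≤ S ⊔ S₀ := le_sup_left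
  have hle₀ : S₀ ≤ S ⊔ S₀ := le_sup_right
  have hfg' : (S ⊔ S₀).FG := hfg.sup hfg₀
  have hfrac' : IsFractionRing ↥(S ⊔ S₀) K :=
    BlowupChartRegular.isFractionRing_of_le S _ hle hfrac
  -- (2) `S'_c = O`
  have hO' : ∀ x : K, x ∈ O →
      ∃ a b : K, a ∈ S ⊔ S₀ ∧ b ∈ S ⊔ S₀ ∧ b ≠ 0 ∧ b⁻¹ ∈ O ∧ x = a / b := by
    intro x hx
    obtain ⟨a, b, ha, hb, hb0, hbinv, rfl⟩ := hO x hx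
    exact ⟨a, b, hle₀ ha, hle₀ hb, hb0, hbinv, rfl⟩
  have hcO : ∀ x : K,
      (∃ a b : K, a ∈ S ⊔ S₀ ∧ b ∈ S ⊔ S₀ ∧ b ≠ 0 ∧ b⁻¹ ∈ O ∧ x = a / b) → x ∈ O := by
    rintro x ⟨a, b, ha, -, -, hbinv, rfl⟩
    rw [div_eq_mul_inv]
    exact mul_mem (h' ha : a ∈ O.toSubring) hbinv
  -- (3) regularity at the centre: `S'_c ≅ O` is a Noetherian valuation ring, a PID
  obtain ⟨hPID, hreg'⟩ := isPrincipalIdealRing_and_isRegularLocalRing O (S ⊔ S₀) h' hfg' hO'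
  -- (4) the saturated rescaling on `S'`
  obtain ⟨g, hg0, hpres, hsat⟩ :=
    stub_saturation p hp k K O (S ⊔ S₀) h' D hfg' hfrac' hreg' hD hpc
  refine ⟨S ⊔ S₀, h', g, hle, hfg', hfrac', hreg', hg0, hpres, Or.inl ?_⟩
  -- (5) non-singularity: `𝔪_O = π O`
  haveI := hPID
  obtain ⟨π, hπ⟩ := Submodule.IsPrincipal.principal (IsLocalRing.maximalIdeal O)
  have hunit : ∀ y : O, y ∉ IsLocalRing.maximalIdeal O → (y : K) ≠ 0 ∧ (y : K)⁻¹ ∈ O :=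
    fun y hy => (not_mem_maximalIdeal_iff_inv_mem O y).mp hy
  by_cases hπ0 : π = 0
  · -- `O` is a field: every non-zero element of `O` is a unit; take `a ∈ S` with `D a ≠ 0`
    obtain ⟨a, ha, hDa⟩ := exists_mem_deriv_ne_zero S hfrac D hD
    have hac : ∃ a' b : K, a' ∈ S ⊔ S₀ ∧ b ∈ S ⊔ S₀ ∧ b ≠ 0 ∧ b⁻¹ ∈ O ∧ a = a' / b :=
      ⟨a, 1, hle ha, one_mem _, one_ne_zero, by rw [inv_one]; exact one_mem O, (div_one a).symm⟩
    have hgDa : (g • D) a ≠ 0 := by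
      rw [Derivation.smul_apply, smul_eq_mul]
      exact mul_ne_zero hg0 hDa
    have hmemO : (g • D) a ∈ O := hcO _ (hpres a hac)
    refine ⟨a, hac, hgDa, (hunit ⟨(g • D) a, hmemO⟩ ?_).2⟩
    rw [hπ, hπ0]
    intro hmem
    rw [Submodule.span_zero_singleton, Submodule.mem_bot] at hmem
    exact hgDa (congrArg Subtype.val hmem)
  · -- `π` is a uniformiser: a non-zero non-unit of `O = S'_c`; saturate at `π`
    have hπmax : π ∈ IsLocalRing.maximalIdeal O := by
      rw [hπ]
      exact Submodule.mem_span_singleton_self π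
    have hπK0 : (π : K) ≠ 0 := fun h => hπ0 (Subtype.ext h)
    have hπnu : ¬ ((π : K) ≠ 0 ∧ (π : K)⁻¹ ∈ O) := fun h =>
      (not_mem_maximalIdeal_iff_inv_mem O π).mpr h hπmax
    obtain ⟨x, hxc, hx⟩ := hsat π ⟨hO' π π.2, hπnu⟩ hπK0
    have hyO : (g • D) x ∈ O := hcO _ (hpres x hxc)
    refine ⟨x, hxc, hunit ⟨(g • D) x, hyO⟩ ?_⟩
    intro hmem
    rw [hπ] at hmem
    obtain ⟨c, hc⟩ := Ideal.mem_span_singleton'.mp hmem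
    apply hx
    have hyc : (g • D) x / π = c := by
      rw [div_eq_iff hπK0]
      exact (congrArg Subtype.val hc).symm
    rw [hyc]
    exact hO' c c.2

end Summit.ResolutionOfSingularities.ResolutionOfSingularities.Theorems.FolLU

end
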